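import Mathlib.CategoryTheory.Groupoid
import Mathlib.CategoryTheory.NatIso
import Mathlib.CategoryTheory.Products.Basic
import Mathlib.CategoryTheory.Action.Basic
import Literature.IUT.HodgeTheaters.Conventions
import HarnessLib

/-!
# [IUTchI] §3, Remarks 3.5.1 (ii)(iii), 3.5.2 (i)(ii), 3.6.1, 3.8.1 (ii)(iii)(iv)
# (remarks to Example 3.5, Definition 3.6 and Corollary 3.8: the Frobenius-picture)

S. Mochizuki, *Inter-universal Teichmüller theory I: construction of Hodge theaters*, §3
"Chains of Θ-Hodge theaters", kurims final manuscript (May 2020) pp. 86–91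
[claim: Mochizuki2012, status: disputed].  One `/-! -/` section per Remark sub-item; the
checkable content is typed as real definitions / `Prop`-valued statements or PROVED where it is
elementary; pure prose (heuristics, analogies) is indexed in the section docstring with status
"noted".  Nothing of the series is asserted; no side is taken on the disputed step of [IUTchIII].
The objects these remarks talk about — Θ-Hodge theaters (Def. 3.6), the Θ-link and the
Frobenius-picture (Cor. 3.7, 3.8), the étale-picture (Cor. 3.9), `F⊩_mod`, `F⊩_tht` (Ex. 3.5) — are
typed by their owner abc-iut-L5-t2 (`ThetaHodgeTheater`, `FrobeniusPicture`,
`FrobeniusPicture.etalePicture`, `HodgeTheaterModel`, staged; Rmk 3.5.1 (i) and Rmk 3.8.1 (i) are in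
its `GlobalRealifiedFrobenioids.lean`) and are NOT re-declared here: the statements below that need
them are phrased over an abstract category / an abstract `ℤ`-indexed family, which is all the remarks
use.  Remarks 3.6.2, 3.7.1 belong to t2 as well; Remarks 3.9.1–3.9.4 are in the sibling file
`ThetaHodgeTheatersRemarksC.lean`.

## What is typed here

* **Rmk 3.5.1 (ii)** (p. 86), **(iii)** (p. 87): noted ("devices for currency exchange";
  the poly-Frobenioid formulation of [FrdII] §5 is "not pursued").
* **Rmk 3.5.2 (i), (ii)** (p. 87) — the CONVENTIONS on "isomorphisms of collections of data": a
  collection of data with its stipulated relationships = a diagram `J ⥤ C`; an isomorphism of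
  collections of data = a natural isomorphism (`DataCollection.Iso`), whose naturality squares ARE
  the "evident compatibility conditions" (`DataCollection.Iso.compat`, PROVED); (ii) the
  category-portion of such an isomorphism is an isomorphism class of equivalences, i.e. the §0 notion
  `CatIsomorphism` of `Conventions.lean` (`DataCollection.categoryPortion`, well-definedness PROVED).
* **Rmk 3.6.1** (p. 88): labelled families `□ ↦ □HT^Θ` (`Labeled`, `Labeled.relabel`).
* **Rmk 3.8.1 (ii)** (p. 90): "one may regard `⁽⁻⁾D⊢_v` as a sort of constant invariant of the
  various Θ-Hodge theaters that constitute the Frobenius-picture" — PROVED in the form the text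
  gives it: a `ℤ`-indexed family of objects linked by isomorphisms `ⁿD⊢_v ⥲ ⁽ⁿ⁺¹⁾D⊢_v` (Cor. 3.7 (ii))
  is constant up to isomorphism (`nonempty_iso_of_chain`), likewise for the pairs
  `(ⁿD⊢_v, O^×_{ⁿC⊢_v})` of Cor. 3.7 (iii) (`nonempty_iso_of_chain_prod`); the "Frobenius-like
  nature" sentence is noted.
* **Rmk 3.8.1 (iii)** (pp. 90–91), **(iv)** (p. 91): noted, with the one structural claim — the
  copies of `G_v` (resp. of `D⊢_v ∈ Ob(TM⊢)`) arising from `ⁿHT^Θ` for distinct `n` "are only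
  related to one another via some indeterminate isomorphism" — being exactly t2's
  `FrobeniusPicture.etalePicture v n m = PolyIso.full` (Cor. 3.9 (i)); the [AbsTopIII] §I3 sentence
  "the ring structure … is obliterated" is typed as the claim-form predicate
  `S3Local.HolomorphicStructureObliterated` (an indeterminate = full poly-isomorphism does not
  preserve a given additional "holomorphic" structure unless every automorphism does).
-/

namespace Literature.IUT.HodgeTheaters

open CategoryTheory

universe v u v' u' w

/-! ## Remark 3.5.1 (ii) ([IUTchI] Rmk 3.5.1 (ii) p.86) — noted

"The global Frobenioids `C⊩_mod`, `C⊩_tht` of Example 3.5 may be thought of as "devices for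
currency exchange" between the various "local currencies" constituted by the divisor monoids at
the various `v ∈ V̲`."  Heuristic gloss on the restriction functors `C_{ρ_v} : C⊩_mod → (C⊢_v)^rlf`
and the isomorphisms `ρ_v` of Ex. 3.5 (i) (typed REAL at the divisor-monoid level by abc-iut-L5-t2,
`InitialThetaData.rho`, `rhoScalar`).  Status: noted. -/

/-! ## Remark 3.5.1 (iii) ([IUTchI] Rmk 3.5.1 (iii) p.87) — noted

"One may also formulate the data contained in `F⊩_mod`, `F⊩_tht` via the language of
poly-Frobenioids as developed in [FrdII], §5, but we shall not pursue this topic in the present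
series of papers."  Status: noted (nothing to type; [FrdII] §5 poly-Frobenioids are layer L1). -/

/-! ## Remark 3.5.2 (i), (ii) ([IUTchI] Rmk 3.5.2 p.87) — conventions on "isomorphisms of collections of data"

"In Example 3.5, as well as in the following discussion, we shall often speak of "isomorphisms of
collections of data", relative to the following conventions.
(i) Such isomorphisms are always assumed to satisfy various evident compatibility conditions,
relative to the various relationships stipulated between the various constituent data, whose
explicit mention we shall omit for the sake of simplicity.
(ii) In situations where the collections of data consist partially of various categories, the
portion of the "isomorphism of collections of data" involving corresponding categories is to be
understood as an isomorphism class of equivalences of categories [cf. §0]."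

Typing.  A collection of data together with the relationships stipulated between its constituents
is a DIAGRAM: a functor `X : J ⥤ C` from the shape `J` (one object per constituent, one arrow per
stipulated relationship) to the ambient category `C` of the constituents.  An isomorphism of two
collections of data of the same shape is then a natural isomorphism `X ≅ Y`; its naturality squares
are precisely the "evident compatibility conditions" of (i).  (abc-iut-L5-t2's `HodgeTheaterModel`
packages the same convention differently — each KIND of collection of data as an abstract groupoid;
the two typings are compatible: the groupoid of `J`-shaped collections in `C` is the core of
`J ⥤ C`.) -/

/-- A *collection of data* of shape `J` with constituents in `C`, together with "the various
relationships stipulated between the various constituent data" (Rmk 3.5.2 (i), p. 87): a diagram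
`J ⥤ C`. [claim: Mochizuki2012, status: disputed] -/
abbrev DataCollection (J : Type u') [Category.{v'} J] (C : Type u) [Category.{v} C] :
    Type (max v' v u' u) :=
  J ⥤ C

namespace DataCollection

variable {J : Type u'} [Category.{v'} J] {C : Type u} [Category.{v} C]

/-- An *isomorphism of collections of data* (Rmk 3.5.2 (i), p. 87): a family of isomorphisms of
the constituents "satisfying the evident compatibility conditions relative to the relationships
stipulated between the constituent data" — a natural isomorphism of diagrams.
[claim: Mochizuki2012, status: disputed] -/
abbrev Iso (X Y : DataCollection J C) : Type (max u' v) := X ≅ Y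

/-- Rmk 3.5.2 (i): the constituent-wise isomorphism at the constituent `j`.
[claim: Mochizuki2012, status: disputed] -/
abbrev Iso.constituent {X Y : DataCollection J C} (e : Iso X Y) (j : J) : X.obj j ≅ Y.obj j :=
  e.app j

/-- Rmk 3.5.2 (i), "evident compatibility conditions": an isomorphism of collections of data is
compatible with every stipulated relationship `f : j ⟶ j'` between constituents. PROVED (it is the
naturality square). [claim: Mochizuki2012, status: disputed] -/
theorem Iso.compat {X Y : DataCollection J C} (e : Iso X Y) {j j' : J} (f : j ⟶ j') :
    X.map f ≫ (e.constituent j').hom = (e.constituent j).hom ≫ Y.map f :=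
  e.hom.naturality f

/-- Rmk 3.5.2 (i): the inverse constituent isomorphisms are compatible as well. PROVED.
[claim: Mochizuki2012, status: disputed] -/
theorem Iso.compat_inv {X Y : DataCollection J C} (e : Iso X Y) {j j' : J} (f : j ⟶ j') :
    Y.map f ≫ (e.constituent j').inv = (e.constituent j).inv ≫ X.map f :=
  e.inv.naturality f

end DataCollection

/-- Rmk 3.5.2 (ii) (p. 87): "the portion of the "isomorphism of collections of data" involving
corresponding categories is to be understood as an isomorphism class of equivalences of categories
[cf. §0]" — i.e. an element of `CatIsomorphism C D` (`Conventions.lean`, [IUTchI] §0 p. 33); the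
class of a given equivalence. [claim: Mochizuki2012, status: disputed] -/
def DataCollection.categoryPortion {C : Type u} [Category.{v} C] {D : Type u'} [Category.{v'} D]
    (e : C ≌ D) : CatIsomorphism C D :=
  CatIsomorphism.mk e

/-- Rmk 3.5.2 (ii): the category-portion only remembers the isomorphism CLASS — two equivalences
with naturally isomorphic functors give the same portion. PROVED.
[claim: Mochizuki2012, status: disputed] -/
theorem DataCollection.categoryPortion_eq_of_iso {C : Type u} [Category.{v} C] {D : Type u'}
    [Category.{v'} D] {e e' : C ≌ D} (i : e.functor ≅ e'.functor) :
    DataCollection.categoryPortion e = DataCollection.categoryPortion e' :=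
  (CatIsomorphism.mk_eq_mk_iff e e').2 ⟨i⟩

/-! ## Remark 3.6.1 ([IUTchI] Rmk 3.6.1 p.88) — labels

"When we discuss various collections of Θ-Hodge theaters, labeled by some symbol "`□`" in place of
a "`†`", we shall apply the notation of Definition 3.6 with "`†`" replaced by "`□`" to denote the
various objects associated to the Θ-Hodge theater labeled by "`□`"."  Typed generically: a family of
objects of a kind `X` (e.g. `X = ThetaHodgeTheater M`, abc-iut-L5-t2) labelled by a type of symbols
`Λ`; Cor. 3.8 uses `Λ = ℤ` (`FrobeniusPicture.HT : ℤ → ThetaHodgeTheater M`). -/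

/-- Rmk 3.6.1 (p. 88): a collection of objects of kind `X` "labeled by some symbol `□`" ranging over
`Λ`; `L □` is "the object associated to the label `□`". [claim: Mochizuki2012, status: disputed] -/
abbrev Labeled (Λ : Type w) (X : Type u) : Type (max w u) := Λ → X

/-- Rmk 3.6.1: relabelling a labelled collection along a map of label sets (e.g. the translation
symmetry `n ↦ n + k` of the Frobenius-picture, Cor. 3.8). [claim: Mochizuki2012, status: disputed] -/
abbrev Labeled.relabel {Λ Λ' : Type w} {X : Type u} (L : Labeled Λ X) (σ : Λ' → Λ) : Labeled Λ' X :=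
  L ∘ σ

/-! ## Remark 3.8.1 (ii) ([IUTchI] Rmk 3.8.1 (ii) p.90)

"It is perhaps not surprising [cf. the theory of [FrdI]] that the Frobenius-picture involves, in an
essential way, the divisor monoid portion [i.e., "`q̲_v`" and "`Θ̲_v`"] of the various Frobenioids
that appear in a Θ-Hodge theater.  Put another way, it is as if the "Frobenius-like nature" of the
divisor monoid portion of the Frobenioids involved induces the "Frobenius-like nature" of the
Frobenius-picture. [noted]  By contrast, observe that for `v ∈ V̲`, the isomorphisms
`… ⥲ ⁿD⊢_v ⥲ ⁽ⁿ⁺¹⁾D⊢_v ⥲ …` of Corollary 3.7, (ii), imply that if one thinks of the various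
`⁽⁻⁾D⊢_v` as being only known up to isomorphism, then one may regard `⁽⁻⁾D⊢_v` as a sort of
constant invariant of the various Θ-Hodge theaters that constitute the Frobenius-picture … Note
that by Corollary 3.7, (iii), we also obtain isomorphisms `… ⥲ O^×_{ⁿC⊢_v} ⥲ O^×_{⁽ⁿ⁺¹⁾C⊢_v} ⥲ …`
lying over the isomorphisms involving the "`⁽⁻⁾D⊢_v`" discussed above."

The checkable content — a `ℤ`-indexed chain of isomorphisms makes the family constant up to
isomorphism — is proved for an arbitrary category (instantiate with t2's `M.Base v`, objects
`(P.HT n).Ddash v`, and the nonempty poly-isomorphisms `thetaLinkBase`; for the last sentence, with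
the product category `M.Base v × M.Units v`). -/

section Chain

variable {C : Type u} [Category.{v} C]

/-- Rmk 3.8.1 (ii), finite steps: isomorphisms `X n ≅ X (n+1)` for all `n` give `X n ≅ X (n + k)`.
PROVED. [claim: Mochizuki2012, status: disputed] -/
theorem nonempty_iso_add_nat (X : ℤ → C) (e : ∀ n : ℤ, Nonempty (X n ≅ X (n + 1))) (n : ℤ) :
    ∀ k : ℕ, Nonempty (X n ≅ X (n + k))
  | 0 => ⟨eqToIso (by simp)⟩
  | k + 1 => by
    obtain ⟨f⟩ := nonempty_iso_add_nat X e n k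
    obtain ⟨g⟩ := e (n + k)
    exact ⟨f ≪≫ g ≪≫ eqToIso (by push_cast; rw [add_assoc])⟩

/-- **Rmk 3.8.1 (ii)** (p. 90): "one may regard `⁽⁻⁾D⊢_v` as a sort of constant invariant of the
various Θ-Hodge theaters that constitute the Frobenius-picture" — a `ℤ`-indexed family of objects
linked by (nonempty sets of) isomorphisms `ⁿX ⥲ ⁽ⁿ⁺¹⁾X` (Cor. 3.7 (ii)) is constant up to
isomorphism: `ⁿX ≅ ᵐX` for all `n, m ∈ ℤ`. PROVED. [claim: Mochizuki2012, status: disputed] -/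
theorem nonempty_iso_of_chain (X : ℤ → C) (e : ∀ n : ℤ, Nonempty (X n ≅ X (n + 1))) (n m : ℤ) :
    Nonempty (X n ≅ X m) := by
  rcases le_total n m with h | h
  · obtain ⟨k, rfl⟩ := Int.le.dest h
    exact nonempty_iso_add_nat X e n k
  · obtain ⟨k, rfl⟩ := Int.le.dest h
    obtain ⟨f⟩ := nonempty_iso_add_nat X e m k
    exact ⟨f.symm⟩

/-- **Rmk 3.8.1 (ii)**, last sentence (p. 90): the isomorphisms `O^×_{ⁿC⊢_v} ⥲ O^×_{⁽ⁿ⁺¹⁾C⊢_v}`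
of Cor. 3.7 (iii) "lying over" those of the `ⁿD⊢_v` make the PAIRS `(ⁿD⊢_v, O^×_{ⁿC⊢_v})` a
constant invariant as well (the chain lemma in the product category). PROVED.
[claim: Mochizuki2012, status: disputed] -/
theorem nonempty_iso_of_chain_prod {D : Type u'} [Category.{v'} D] (X : ℤ → C) (U : ℤ → D)
    (e : ∀ n : ℤ, Nonempty (((X n, U n) : C × D) ≅ (X (n + 1), U (n + 1)))) (n m : ℤ) :
    Nonempty (((X n, U n) : C × D) ≅ (X m, U m)) :=
  nonempty_iso_of_chain (C := C × D) (fun k => (X k, U k)) e n m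

end Chain

/-! ## Remark 3.8.1 (iii) ([IUTchI] Rmk 3.8.1 (iii) pp.90–91) — noted, one predicate

"In the situation of (ii), suppose that `v ∈ V̲^non`.  Then `⁽⁻⁾D⊢_v` is simply the category of
connected objects of the Galois category associated to the profinite group `G_v`.  That is to say,
one may think of `⁽⁻⁾D⊢_v` as representing "`G_v` up to isomorphism".  Then each `ⁿD_v` represents
an "isomorph of the topological group `Π_v`, labeled by `n`, which is regarded as an extension of
some isomorph of `G_v` that is independent of `n`".  In particular, the quotients corresponding to
`G_v` of the copies of `Π_v` that arise from `ⁿHT^Θ` for different `n` are only related to one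
another via some indeterminate isomorphism.  Thus, from the point of view of the theory of
[AbsTopIII] [cf. [AbsTopIII], §I3; [AbsTopIII], Remark 5.10.2, (ii)], each `Π_v` gives rise to a
well-defined ring structure — i.e., a "holomorphic structure" — which is obliterated by the
indeterminate isomorphism between the quotient isomorphs of `G_v` arising from `ⁿHT^Θ` for
distinct `n`."

The structural claim "only related … via some indeterminate isomorphism" is Cor. 3.9 (i) as typed
by abc-iut-L5-t2: `FrobeniusPicture.etalePicture v n m = PolyIso.full _ _` (the FULL
poly-isomorphism, no distinguished member).  The last sentence is typed below as a predicate: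
a structure carried by an object is "obliterated" by the full poly-isomorphism when not every
automorphism preserves it (for `G_v = G_K` of an MLF the existence of automorphisms of the
profinite group not arising from ring/field theory is [AbsTopIII] §I3 / [NSW] — a deep input of
layer L4, NOT asserted here). -/

namespace S3Local

/-- Rmk 3.8.1 (iii)/(iv) (pp. 90–91), claim-form: an additional structure on an object `A` of a
category — recorded abstractly as a predicate `IsHol` singling out the "holomorphic"
(structure-preserving) automorphisms — is **obliterated by the indeterminate isomorphism**, i.e. by
the full poly-automorphism `PolyIso.full A A`, when some automorphism of `A` is not holomorphic.
(TODO-merge:abc-iut-L4-t2 [AbsTopIII] §I3 / Rmk 5.10.2 (ii) supplies `IsHol` and the witness for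
`A = G_v`; TODO-merge:abc-iut-L5-t2 `FrobeniusPicture.etalePicture`.)
[claim: Mochizuki2012, status: disputed] -/
def HolomorphicStructureObliterated {C : Type u} [Category.{v} C] (A : C)
    (IsHol : (A ≅ A) → Prop) : Prop :=
  ∃ α : A ≅ A, α ∈ PolyIso.full A A ∧ ¬ IsHol α

/-- Unfolding: since the indeterminate (full) poly-isomorphism contains EVERY automorphism, the
structure is obliterated iff not all automorphisms are holomorphic. PROVED.
[claim: Mochizuki2012, status: disputed] -/
theorem holomorphicStructureObliterated_iff {C : Type u} [Category.{v} C] (A : C)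
    (IsHol : (A ≅ A) → Prop) :
    HolomorphicStructureObliterated A IsHol ↔ ¬ ∀ α : A ≅ A, IsHol α := by
  simp only [HolomorphicStructureObliterated, PolyIso.full, Set.mem_univ, true_and, not_forall]

end S3Local

/-! ## Remark 3.8.1 (iv) ([IUTchI] Rmk 3.8.1 (iv) p.91) — noted

"In the situation of (ii), suppose that `v ∈ V̲^arc`.  Then `⁽⁻⁾D⊢_v` is an object of `TM⊢`; each
`ⁿD_v` represents an "isomorph of the Aut-holomorphic orbispace `X̲→_v`, labeled by `n`, whose
associated [complex archimedean] topological field `A_{X̲→_v}` gives rise to an isomorph of `D⊢_v`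
that is independent of `n`".  In particular, the various isomorphs of `D⊢_v` associated to the
copies of `X̲→_v` that arise from `ⁿHT^Θ` for different `n` are only related to one another via some
indeterminate isomorphism.  Thus … each `X̲→_v` gives rise to a well-defined ring structure — i.e., a
"holomorphic structure" — which is obliterated by the indeterminate isomorphism between the
isomorphs of `D⊢_v` arising from `ⁿHT^Θ` for distinct `n`."  Archimedean counterpart of (iii): the
same two typed items apply (`FrobeniusPicture.etalePicture` of abc-iut-L5-t2 at `v ∈ V̲^arc`;
`S3Local.HolomorphicStructureObliterated` with `A = D⊢_v ∈ Ob(TM⊢)`, `TM⊢` = t2's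
`SplitTopMonoid`).  Status: noted. -/

/-! ## Remark 3.8.1 (iii), appended: the group-theoretic kernel of "`G_v` up to isomorphism"

(v2, append-only.)  "`⁽⁻⁾D⊢_v` is simply the category of connected objects of the Galois category
associated to the profinite group `G_v`.  That is to say, one may think of `⁽⁻⁾D⊢_v` as representing
"`G_v` up to isomorphism"" (p. 90).  PROVED here in the generality of `G`-objects in any category
`V` (Mathlib `Action V G`; the Galois category of finite `G`-sets is the case `V = FintypeCat`): the
assignment `G ↦ (Action V G)` is functorial in ISOMORPHISMS of `G` (`Action.resEquiv`) and INNER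
automorphisms act by functors isomorphic to the identity, so the category sees `G` at most up to
isomorphism and is blind to conjugacy — which is why the copies of `G_v` arising from distinct
`ⁿHT^Θ` are related "only via some indeterminate isomorphism" at no cost to `D⊢_v`. -/

namespace EtalePictureGroupoid

variable (V : Type u) [Category.{v} V] (G : Type w) [Group G]

/-- Rmk 3.8.1 (iii) (p. 90: "one may think of `⁽⁻⁾D⊢_v` as representing '`G_v` up to
isomorphism'"): on the category of `G`-objects in any category `V`, restriction along an INNER
automorphism `conj(g)` of `G` is naturally isomorphic to the identity functor (the isomorphism at
`M` is the action of `g⁻¹`).  Hence the category `B(G)` of `G`-sets — and its connected part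
`B(G)⁰ = D⊢_v` for `G = G_v` — only "sees" `G` up to inner automorphisms. PROVED.
[claim: Mochizuki2012, status: disputed] -/
noncomputable def resConjIso (g : G) :
    Action.res V (MulAut.conj g).toMonoidHom ≅ 𝟭 (Action V G) :=
  NatIso.ofComponents
    (fun M => Action.mkIso (M.ρAut g⁻¹) (fun h => by
      change M.ρ (g * h * g⁻¹) ≫ M.ρ g⁻¹ = M.ρ g⁻¹ ≫ M.ρ h
      rw [← End.mul_def, ← map_mul, ← End.mul_def, ← map_mul]
      congr 1
      rw [mul_assoc g h g⁻¹, inv_mul_cancel_left]))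
    (fun {M N} p => by
      ext
      change p.hom ≫ N.ρ g⁻¹ = M.ρ g⁻¹ ≫ p.hom
      exact (p.comm g⁻¹).symm)

/-- Rmk 3.8.1 (iii): consequently an inner automorphism of `G` acts on `G`-objects by a functor
isomorphic to the identity — "the quotients corresponding to `G_v` … are only related to one
another via some indeterminate isomorphism" costs nothing at the level of `D⊢_v`. PROVED.
[claim: Mochizuki2012, status: disputed] -/
theorem nonempty_resConj_iso_id (g : G) :
    Nonempty (Action.res V (MulAut.conj g).toMonoidHom ≅ 𝟭 (Action V G)) :=
  ⟨resConjIso V G g⟩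

/-- Rmk 3.8.1 (iii), "`G_v` up to isomorphism": an isomorphism of groups `G ≃* H` identifies the
categories of `G`- and `H`-objects (Mathlib's `Action.resEquiv`), so the category determines the
group at most up to isomorphism. PROVED (by citation of the Mathlib equivalence).
[claim: Mochizuki2012, status: disputed] -/
theorem nonempty_equivalence_of_mulEquiv {H : Type w} [Group H] (e : G ≃* H) :
    Nonempty (Action V H ≌ Action V G) :=
  ⟨Action.resEquiv V e⟩

end EtalePictureGroupoid

end Literature.IUT.HodgeTheaters
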